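import Summits.ABC.ABC.Theses.DefiniteXi
import Literature.NumberTheory.EllipticCurves.ModularDegreeMinimal
import HarnessLib

/-!
# Route DefiniteXi — support item `MinimalBoundGivesTarget` (stmt-ABC-3328)

The glue between the definite-side degree bound for MINIMAL parametrisation data and the `∃`-form
thesis `FreyDegreeBound` of route `DefiniteXi`:

> if every Frey–Hellegouarch curve `E_{a,b}` (`a, b` coprime, `ab(a+b) ≠ 0`) carries some modular
> parametrisation datum at its conductor level `N` (modularity, the item `FreyModularity`), and for
> every `ε > 0` there is `C` such that every minimal-degree datum `D` of `E_{a,b}` at level `N`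
> has `deg D ≤ C · N^{2+ε}`, then `FreyDegreeBound` holds.

Pure logic plus the well-ordering of `ℕ`: a nonempty type of data has a datum of least degree
(`Literature.NumberTheory.EllipticCurves.ModularForms.exists_minimal_datum`, i.e. `Nat.sInf_mem`),
that datum is minimal in the `∀ D', D.deg ≤ D'.deg` sense the hypothesis consumes, and it
witnesses the `∃ D` of the thesis with the same constant `C`. No literature input (the frame
"degree conjecture ⟹ abc" of Murty 1999 is elsewhere in the route); closes `--workitem stmt-ABC-3328`.
-/

-- `Summit.<Summit>.<Problem>` is the mandated summit-side namespace (CONVENTIONS §2); for the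
-- single-conjunct summit `ABC` the two coincide, so the duplicate `ABC.ABC` is deliberate.
set_option linter.dupNamespace false

namespace Summit.ABC.ABC.Theorems

open Literature.NumberTheory.EllipticCurves Literature.NumberTheory.EllipticCurves.ModularForms

/-- **`MinimalBoundGivesTarget` holds** (route `DefiniteXi`, item stmt-ABC-3328): existence of a
parametrisation datum for every Frey curve at its conductor level, together with the bound
`deg D ≤ C_ε N^{2+ε}` for every MINIMAL-degree datum `D`, gives `FreyDegreeBound`
(`∃ D, deg D ≤ C_ε N^{2+ε}`). Proof: for `ε > 0` take the `C` of the second hypothesis; given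
`(a, b, N)`, the first hypothesis makes the type of data nonempty, `exists_minimal_datum` supplies a
datum `D` of least degree, and the bound for `D` is the required witness. -/
theorem minimalBoundGivesTarget_proof :
    Summit.ABC.ABC.Theses.DefiniteXi.MinimalBoundGivesTarget := by
  unfold Summit.ABC.ABC.Theses.DefiniteXi.MinimalBoundGivesTarget
    Summit.ABC.ABC.Theses.DefiniteXi.FreyDegreeBound
  intro hEx hMin ε hε
  obtain ⟨C, hC⟩ := hMin ε hε
  refine ⟨C, fun a b hab h0 N _ hN ↦ ?_⟩
  obtain ⟨D, -, hDmin⟩ := exists_minimal_datum (hEx a b hab h0 N hN)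
  exact ⟨D, hC a b hab h0 N hN D hDmin⟩

end Summit.ABC.ABC.Theorems
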